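import Literature.MathematicalPhysics.QuantumFieldTheory.LatticeGaugeAsymptoticsFreeEnergyProofs
import HarnessLib

/-!
# Chatterjee's free-energy asymptotics: comparison of cube free energies across scales (Lemmas 17.3, 17.5)

S. Chatterjee, *The leading term of the Yang–Mills free energy*, J. Funct. Anal. 271 (2016),
arXiv:1602.01222, §17 — seventh step of the inline proof of the named fact
`Literature.MathematicalPhysics.QuantumFieldTheory.chatterjee_freeEnergyDensity`. Everything is
proved; no named fact is introduced; the setting is a continuous matrix representation `ρ` of a
compact second-countable group (as in the sibling `LatticeGaugeAsymptoticsFreeEnergyProofs`).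

Tile the cube `[0,(n+1)k)^d` by the `k^d` translates (spacing `n+1`, hence edge-disjoint) of the
box of plaquettes based in `[0,n)^d` (`tiling`; the tree's `FreeEnergy.zdZ_biUnion_translate`
factorises its partition function as `Z(𝔅⟦n⟧)^{k^d}`), and compare with the genuine plaquettes of
the cubes (`cubePlaqs`, `#(𝔅⟦n⟧ ∖ cubePlaqs n) ≤ 2·#planes·n^{d-1}`):

* `log_Z_mul_le` (**Lemma 17.3**): for `β ≥ 0` and `Re tr ρ ≤ N` (weights `≤ 1`),
  `log Z(B_{(n+1)k}) ≤ k^d log Z(B_n)`; hence `freeEnergyDensity_le`: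
  `f(β) ≤ log Z(B_n,β)/(n+1)^d`.
* `le_log_Z_mul` (**Lemma 17.5**): with `|Re tr ρ| ≤ M` (each dropped plaquette costs at most
  `e^{|β|(N+M)}`), `k^d(log Z(B_n) - 2|β|(N+M)·#planes·n^{d-1}) - |β|(N+M)·#planes·k^d((n+1)^d-n^d)
  ≤ log Z(B_{(n+1)k})`; hence `le_freeEnergyDensity`:
  `log Z(B_n,β)/(n+1)^d - |β|(N+M)·#planes·(d+2)/(n+1) ≤ f(β)`.

Here `f(β) = freeEnergyDensity d ρ β` is the torus free energy density of `LatticeGaugeDLR`, the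
limit of the cube free energies by `tendsto_freeEnergyPerSite_halfOpenBox`.

## References

* S. Chatterjee, *The leading term of the Yang–Mills free energy*, J. Funct. Anal. 271 (2016)
  2944–3005, arXiv:1602.01222, §17, Lemmas 17.3 and 17.5. [arXiv160201222]
-/

noncomputable section

open MeasureTheory Filter Topology Finset
open Literature.Probability.LatticeModels Literature.MathematicalPhysics.QuantumLattice

namespace Literature.MathematicalPhysics.QuantumFieldTheory

namespace ChatterjeeFreeEnergy

variable {d : ℕ}

/-- The box of plaquettes of `ℤ^d` based in `[0, n)^d`, any plane (local notation, as in
`LatticeGaugeDLRFreeEnergyProofs`). [folklore] -/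
local notation3 (prettyPrint := false) "𝔅⟦" n "⟧" =>
  (halfOpenBox d n ×ˢ Finset.univ : Finset (ZdPlaquette d))

/-- Translation of plaquettes by `v ∈ ℤ^d` (local notation, as in `LatticeGaugeDLRFreeEnergyProofs`). [folklore] -/
local notation3 (prettyPrint := false) "𝔰⟦" v "⟧" =>
  fun p : ZdPlaquette d => (p.1 + v, p.2)

/-! ### Geometry: the genuine plaquettes of a cube, faces, tilings -/

variable (d) in
/-- The plaquettes of the box `𝔅⟦n⟧` that are genuine plaquettes of the cube `[0,n)^d` (all four
corners inside), as `ZdPlaquette`s. [folklore] -/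
def cubePlaqs (n : ℕ) : Finset (ZdPlaquette d) :=
  (𝔅⟦n⟧).filter fun p => Plaq.ofZd p ∈ plaquettesIn (halfOpenBox d n)

/-- `cubePlaqs n ⊆ 𝔅⟦n⟧`. [folklore] -/
theorem cubePlaqs_subset (n : ℕ) : cubePlaqs d n ⊆ 𝔅⟦n⟧ := filter_subset _ _

/-- The genuine plaquettes of the cube are exactly the labels of `plaquettesIn`. [folklore] -/
theorem image_ofZd_cubePlaqs (n : ℕ) : (cubePlaqs d n).image Plaq.ofZd = plaquettesIn (halfOpenBox d n) := by
  ext q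
  rw [mem_image]
  constructor
  · rintro ⟨p, hp, rfl⟩
    exact (mem_filter.1 hp).2
  · intro hq
    have hq' := Plaq.mem_plaquettesIn.1 hq
    exact ⟨(q.1, ⟨(q.2.1, q.2.2), hq'.2.1⟩), mem_filter.2 ⟨mem_product.2 ⟨hq'.1, mem_univ _⟩, hq⟩, rfl⟩

/-- A face of the cube has at most `n^{d-1}` points. [folklore] -/
theorem card_filter_coord_eq_le (n : ℕ) (i : Fin d) (c : ℤ) :
    #((halfOpenBox d n).filter fun x : Literature.Probability.LatticeModels.Site d => x i = c) ≤ n ^ (d - 1) := by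
  classical
  have hsub : (halfOpenBox d n).filter (fun x : Literature.Probability.LatticeModels.Site d => x i = c) ⊆
      Fintype.piFinset (Function.update (fun _ : Fin d => Finset.Ico (0 : ℤ) n) i {c}) := by
    intro x hx
    rw [mem_filter, mem_halfOpenBox] at hx
    rw [Fintype.mem_piFinset]
    intro l
    by_cases hl : l = i
    · subst hl; rw [Function.update_self, mem_singleton]; exact hx.2
    · rw [Function.update_of_ne hl, Finset.mem_Ico]; exact hx.1 l
  refine (card_le_card hsub).trans ?_
  rw [Fintype.card_piFinset, ← Finset.mul_prod_erase univ _ (mem_univ i), Function.update_self, card_singleton, one_mul]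
  rw [Finset.prod_congr rfl (fun l hl => by rw [Function.update_of_ne (ne_of_mem_erase hl)])]
  simp only [Int.card_Ico, sub_zero, Int.toNat_natCast, prod_const]
  rw [card_erase_of_mem (mem_univ i), Finset.card_univ, Fintype.card_fin]

/-- **Plaquettes based in the cube but sticking out** are few:
`#(𝔅⟦n⟧ ∖ cubePlaqs n) ≤ 2 · #planes · n^{d-1}`. [folklore] -/
theorem card_boxPlaqs_sdiff_cubePlaqs_le (n : ℕ) :
    #(𝔅⟦n⟧ \ cubePlaqs d n) ≤ 2 * Fintype.card {q : Fin d × Fin d // q.1 < q.2} * n ^ (d - 1) := by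
  classical
  set F : {q : Fin d × Fin d // q.1 < q.2} → Finset (ZdPlaquette d) := fun pl =>
    (((halfOpenBox d n).filter fun x : Literature.Probability.LatticeModels.Site d => x pl.1.1 = (n : ℤ) - 1) ∪
      ((halfOpenBox d n).filter fun x : Literature.Probability.LatticeModels.Site d => x pl.1.2 = (n : ℤ) - 1)) ×ˢ {pl} with hF
  have hsub : 𝔅⟦n⟧ \ cubePlaqs d n ⊆ univ.biUnion F := by
    intro p hp
    rw [Finset.mem_sdiff] at hp
    obtain ⟨hbox, hnot⟩ := hp
    have hx : ∀ k, 0 ≤ p.1 k ∧ p.1 k < n := FreeEnergy.mem_boxPlaqs.1 hbox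
    rw [cubePlaqs, mem_filter, not_and] at hnot
    have hnot' := hnot hbox
    rw [Plaq.mem_plaquettesIn] at hnot'
    simp only [Plaq.ofZd, mem_halfOpenBox] at hnot'
    have hor : p.1 p.2.1.1 = (n : ℤ) - 1 ∨ p.1 p.2.1.2 = (n : ℤ) - 1 := by
      by_contra hcon
      push Not at hcon
      obtain ⟨h1, h2⟩ := hcon
      have hi : p.1 p.2.1.1 + 1 < n := by have := (hx p.2.1.1).2; omega
      have hj : p.1 p.2.1.2 + 1 < n := by have := (hx p.2.1.2).2; omega
      apply hnot'
      have hij : p.2.1.1 ≠ p.2.1.2 := ne_of_lt p.2.2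
      refine ⟨fun k => hx k, p.2.2, fun k => ?_, fun k => ?_, fun k => ?_⟩
      · by_cases hk : k = p.2.1.1
        · subst hk; simp; exact ⟨by linarith [(hx p.2.1.1).1], hi⟩
        · simp [Pi.single_eq_of_ne hk]; exact hx k
      · by_cases hk : k = p.2.1.2
        · subst hk; simp; exact ⟨by linarith [(hx p.2.1.2).1], hj⟩
        · simp [Pi.single_eq_of_ne hk]; exact hx k
      · by_cases hk : k = p.2.1.1
        · subst hk; simp [Pi.single_eq_of_ne hij]; exact ⟨by linarith [(hx p.2.1.1).1], hi⟩
        · by_cases hk' : k = p.2.1.2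
          · subst hk'; simp [Pi.single_eq_of_ne (Ne.symm hij)]; exact ⟨by linarith [(hx p.2.1.2).1], hj⟩
          · simp [Pi.single_eq_of_ne hk, Pi.single_eq_of_ne hk']; exact hx k
    refine mem_biUnion.2 ⟨p.2, mem_univ _, ?_⟩
    rw [hF, mem_product, mem_singleton, mem_union, mem_filter, mem_filter]
    exact ⟨hor.elim (fun h => Or.inl ⟨(mem_product.1 hbox).1, h⟩) (fun h => Or.inr ⟨(mem_product.1 hbox).1, h⟩), rfl⟩
  refine (card_le_card hsub).trans (card_biUnion_le.trans ?_)
  calc ∑ pl : {q : Fin d × Fin d // q.1 < q.2}, #(F pl)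
      ≤ ∑ _pl : {q : Fin d × Fin d // q.1 < q.2}, 2 * n ^ (d - 1) := Finset.sum_le_sum fun pl _ => by
        rw [hF, card_product, card_singleton, mul_one]
        refine (card_union_le _ _).trans ?_
        have h1 := card_filter_coord_eq_le (d := d) n pl.1.1 ((n : ℤ) - 1)
        have h2 := card_filter_coord_eq_le (d := d) n pl.1.2 ((n : ℤ) - 1)
        omega
    _ = 2 * Fintype.card {q : Fin d × Fin d // q.1 < q.2} * n ^ (d - 1) := by
        rw [sum_const, card_univ, smul_eq_mul]; ring

variable (d) in
/-- The tiling of the big cube `[0, (n+1)k)^d` by `k^d` translates of the box of plaquettes `𝔅⟦n⟧`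
(spacing `n + 1`, so that the translates are edge-disjoint). [cite: arXiv160201222, Lemma 17.3 (proof)] -/
def tiling (n k : ℕ) : Finset (ZdPlaquette d) :=
  (halfOpenBox d k).biUnion fun v => (𝔅⟦n⟧).image 𝔰⟦(((n + 1 : ℕ) : ℤ)) • v⟧

/-- The tiles lie inside the big cube. [folklore] -/
theorem image_ofZd_tiling_subset (n k : ℕ) :
    (tiling d n k).image Plaq.ofZd ⊆ plaquettesIn (halfOpenBox d ((n + 1) * k)) := by
  intro q hq
  obtain ⟨p, hp, rfl⟩ := mem_image.1 hq
  rw [tiling, mem_biUnion] at hp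
  obtain ⟨v, hv, hp⟩ := hp
  obtain ⟨p₀, hp₀, rfl⟩ := mem_image.1 hp
  have hv' : ∀ l, 0 ≤ v l ∧ v l < k := mem_halfOpenBox.1 hv
  have h₀ : Plaq.ofZd p₀ ∈ plaquettesIn (halfOpenBox d (n + 1)) :=
    image_ofZd_subset_plaquettesIn n (mem_image_of_mem _ hp₀)
  set w : Literature.Probability.LatticeModels.Site d := (((n + 1 : ℕ) : ℤ)) • v with hw
  have hshift : Plaq.ofZd (p₀.1 + w, p₀.2) = Plaq.shift w (Plaq.ofZd p₀) := rfl
  rw [hshift]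
  have hmem : Plaq.shift w (Plaq.ofZd p₀) ∈ plaquettesIn ((halfOpenBox d (n + 1)).image (· + w)) := by
    rw [Plaq.plaquettesIn_image_add]; exact mem_image_of_mem _ h₀
  refine Plaq.plaquettesIn_mono ?_ hmem
  intro y hy
  obtain ⟨x, hx, rfl⟩ := mem_image.1 hy
  rw [mem_halfOpenBox] at hx ⊢
  intro l
  obtain ⟨hx0, hx1⟩ := hx l
  obtain ⟨hv0, hv1⟩ := hv' l
  simp only [Pi.add_apply, hw, Pi.smul_apply, smul_eq_mul]
  push_cast
  constructor
  · nlinarith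
  · have : (v l + 1) * ((n : ℤ) + 1) ≤ k * ((n : ℤ) + 1) := by
      apply mul_le_mul_of_nonneg_right _ (by positivity); omega
    push_cast at hx1
    nlinarith

/-- The tiling has `k^d · n^d · #planes` plaquettes. [folklore] -/
theorem card_tiling (n k : ℕ) :
    #(tiling d n k) = k ^ d * (n ^ d * Fintype.card {q : Fin d × Fin d // q.1 < q.2}) := by
  classical
  rw [tiling, card_biUnion]
  · rw [Finset.sum_congr rfl (fun v _ => by rw [card_image_of_injective _ (FreeEnergy.shift_injective _), FreeEnergy.card_boxPlaqs]),
      sum_const, card_halfOpenBox, smul_eq_mul]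
  · intro v _ w _ hvw
    exact FreeEnergy.disjoint_image_shift (le_refl (n + 1)) hvw

/-! ### Weights and partition functions -/

variable {N : ℕ} {G : Type*} [Group G] [TopologicalSpace G] [IsTopologicalGroup G]
  [CompactSpace G] [MeasurableSpace G] [BorelSpace G] (ρ : G →* Matrix (Fin N) (Fin N) ℂ)

/-- The Boltzmann weight of one genuine plaquette (local notation, as in the sibling files). [folklore] -/
local notation3 (prettyPrint := false) "𝔴⟦" β ", " p ", " U "⟧" =>
  Real.exp (-β * ((N : ℝ) - plaquetteObs ρ (Prod.fst p) (Prod.snd p).1.1 (Prod.snd p).1.2 U))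

/-- The free-boundary partition function of a set of genuine plaquettes (local notation). [folklore] -/
local notation3 (prettyPrint := false) "ℨ⟦" β ", " A "⟧" =>
  ∫ U, ∏ p ∈ A, 𝔴⟦β, p, U⟧ ∂zdHaar d G

/-- The Boltzmann weight of a plaquette label (local notation, as in the sibling file). [folklore] -/
local notation3 (prettyPrint := false) "𝔳⟦" β ", " q ", " U "⟧" =>
  Real.exp (-β * ((N : ℝ) -
    (ρ (ZdGaugeConfig.plaquette U (Prod.fst q) (Prod.snd q).1 (Prod.snd q).2)).trace.re))

omit [TopologicalSpace G] [IsTopologicalGroup G] [CompactSpace G] [MeasurableSpace G] [BorelSpace G] in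
/-- For `β ≥ 0` and `Re tr ρ ≤ N` the genuine-plaquette weights are at most one. [folklore] -/
theorem boxWeight_le_one (hρN : ∀ g, (ρ g).trace.re ≤ N) {β : ℝ} (hβ : 0 ≤ β) (p : ZdPlaquette d)
    (U : ZdGaugeConfig d G) : 𝔴⟦β, p, U⟧ ≤ 1 := by
  rw [Real.exp_le_one_iff]
  have h : plaquetteObs ρ p.1 p.2.1.1 p.2.1.2 U ≤ N := hρN _
  nlinarith

omit [TopologicalSpace G] [IsTopologicalGroup G] [CompactSpace G] [MeasurableSpace G] [BorelSpace G] in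
/-- For `β ≥ 0` and `Re tr ρ ≤ N` the label weights are at most one. [folklore] -/
theorem labelWeight_le_one (hρN : ∀ g, (ρ g).trace.re ≤ N) {β : ℝ} (hβ : 0 ≤ β) (q : Plaq d)
    (U : ZdGaugeConfig d G) : 𝔳⟦β, q, U⟧ ≤ 1 := by
  rw [Real.exp_le_one_iff]
  have h : (ρ (ZdGaugeConfig.plaquette U q.1 q.2.1 q.2.2)).trace.re ≤ N := hρN _
  nlinarith

omit [TopologicalSpace G] [IsTopologicalGroup G] [CompactSpace G] [MeasurableSpace G] [BorelSpace G] in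
/-- **Dropping plaquettes with weights `≤ 1` increases the product.** [folklore] -/
theorem prod_labelWeight_le_of_subset (hρN : ∀ g, (ρ g).trace.re ≤ N) {β : ℝ} (hβ : 0 ≤ β)
    {S T : Finset (Plaq d)} (hTS : T ⊆ S) (U : ZdGaugeConfig d G) :
    ∏ q ∈ S, 𝔳⟦β, q, U⟧ ≤ ∏ q ∈ T, 𝔳⟦β, q, U⟧ := by
  rw [← prod_sdiff hTS]
  refine mul_le_of_le_one_left (prod_nonneg fun _ _ => (Real.exp_pos _).le) ?_
  exact prod_le_one (fun _ _ => (Real.exp_pos _).le) fun q _ => labelWeight_le_one ρ hρN hβ q U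

omit [TopologicalSpace G] [IsTopologicalGroup G] [CompactSpace G] [MeasurableSpace G] [BorelSpace G] in
/-- Dropping genuine plaquettes with weights `≤ 1` increases the product. [folklore] -/
theorem prod_boxWeight_le_of_subset (hρN : ∀ g, (ρ g).trace.re ≤ N) {β : ℝ} (hβ : 0 ≤ β)
    {S T : Finset (ZdPlaquette d)} (hTS : T ⊆ S) (U : ZdGaugeConfig d G) :
    ∏ p ∈ S, 𝔴⟦β, p, U⟧ ≤ ∏ p ∈ T, 𝔴⟦β, p, U⟧ := by
  rw [← prod_sdiff hTS]
  refine mul_le_of_le_one_left (prod_nonneg fun _ _ => (Real.exp_pos _).le) ?_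
  exact prod_le_one (fun _ _ => (Real.exp_pos _).le) fun p _ => boxWeight_le_one ρ hρN hβ p U

omit [TopologicalSpace G] [IsTopologicalGroup G] [CompactSpace G] [MeasurableSpace G] [BorelSpace G] in
/-- **Dropping plaquettes costs at most `e^{|β|(N+M)}` each.** [folklore] -/
theorem pow_mul_prod_labelWeight_le {M : ℝ} (hM : ∀ g, |(ρ g).trace.re| ≤ M) (β : ℝ)
    {S T : Finset (Plaq d)} (hTS : T ⊆ S) (U : ZdGaugeConfig d G) :
    Real.exp (-(|β| * (N + M))) ^ #(S \ T) * ∏ q ∈ T, 𝔳⟦β, q, U⟧ ≤ ∏ q ∈ S, 𝔳⟦β, q, U⟧ := by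
  rw [← prod_sdiff hTS]
  refine mul_le_mul_of_nonneg_right ?_ (prod_nonneg fun _ _ => (Real.exp_pos _).le)
  rw [← prod_const]
  exact prod_le_prod (fun _ _ => (Real.exp_pos _).le) fun q _ =>
    Real.exp_le_exp.2 (abs_le.1 (FreeEnergy.abs_mul_cost_le ρ hM β _)).1

omit [TopologicalSpace G] [IsTopologicalGroup G] [CompactSpace G] [MeasurableSpace G] [BorelSpace G] in
/-- Dropping genuine plaquettes costs at most `e^{|β|(N+M)}` each. [folklore] -/
theorem pow_mul_prod_boxWeight_le {M : ℝ} (hM : ∀ g, |(ρ g).trace.re| ≤ M) (β : ℝ)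
    {S T : Finset (ZdPlaquette d)} (hTS : T ⊆ S) (U : ZdGaugeConfig d G) :
    Real.exp (-(|β| * (N + M))) ^ #(S \ T) * ∏ p ∈ T, 𝔴⟦β, p, U⟧ ≤ ∏ p ∈ S, 𝔴⟦β, p, U⟧ := by
  rw [← prod_sdiff hTS]
  refine mul_le_mul_of_nonneg_right ?_ (prod_nonneg fun _ _ => (Real.exp_pos _).le)
  rw [← prod_const]
  exact prod_le_prod (fun _ _ => (Real.exp_pos _).le) fun p _ =>
    Real.exp_le_exp.2 (abs_le.1 (FreeEnergy.abs_mul_cost_le ρ hM β _)).1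

variable [SecondCountableTopology G]

/-- The cube partition function as the box partition function of its genuine plaquettes:
`Z(B_n).toReal = Z(cubePlaqs n)`. [folklore] -/
theorem zdPartitionFunction_toReal_eq (hρ : Continuous ρ) (β : ℝ) (n : ℕ) :
    (zdPartitionFunction ρ β (halfOpenBox d n)).toReal = ℨ⟦β, cubePlaqs d n⟧ := by
  rw [zdPartitionFunction_eq_ofReal ρ hρ β, ENNReal.toReal_ofReal (integral_nonneg fun U => prod_nonneg fun _ _ => (Real.exp_pos _).le)]
  rw [← image_ofZd_cubePlaqs n]
  simp_rw [prod_image_ofZd]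

/-- **Upper scale comparison (Lemma 17.3)**: for `β ≥ 0` and `Re tr ρ ≤ N`,
`log Z(B_{(n+1)k}) ≤ k^d log Z(B_n)` (drop all plaquettes outside `k^d` edge-disjoint translates
of `B_n`, then the plaquettes of the tiles sticking out of the translated cubes). [cite: arXiv160201222, Lemma 17.3] -/
theorem log_Z_mul_le (hρ : Continuous ρ) (hρN : ∀ g, (ρ g).trace.re ≤ N) {β : ℝ} (hβ : 0 ≤ β) (n k : ℕ) :
    Real.log (zdPartitionFunction ρ β (halfOpenBox d ((n + 1) * k))).toReal ≤
      k ^ d * Real.log (zdPartitionFunction ρ β (halfOpenBox d n)).toReal := by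
  set Q : Finset (Plaq d) := plaquettesIn (halfOpenBox d ((n + 1) * k)) with hQ
  have hiQ : Integrable (fun U : ZdGaugeConfig d G => ∏ q ∈ Q, 𝔳⟦β, q, U⟧) (zdHaar d G) :=
    AreaLaw.integrable_zdHaar_of_continuous (continuous_labelWeight ρ hρ β Q)
  have hiT : Integrable (fun U : ZdGaugeConfig d G => ∏ p ∈ tiling d n k, 𝔴⟦β, p, U⟧) (zdHaar d G) :=
    FreeEnergy.integrable_boxWeight ρ hρ β _
  have hiB : Integrable (fun U : ZdGaugeConfig d G => ∏ p ∈ 𝔅⟦n⟧, 𝔴⟦β, p, U⟧) (zdHaar d G) :=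
    FreeEnergy.integrable_boxWeight ρ hρ β _
  have hiC : Integrable (fun U : ZdGaugeConfig d G => ∏ p ∈ cubePlaqs d n, 𝔴⟦β, p, U⟧) (zdHaar d G) :=
    FreeEnergy.integrable_boxWeight ρ hρ β _
  -- `Z(B_big) ≤ Z(tiling) = Z(𝔅⟦n⟧)^{k^d} ≤ Z(cube)^{k^d}`
  have h1 : (zdPartitionFunction ρ β (halfOpenBox d ((n + 1) * k))).toReal ≤ ℨ⟦β, tiling d n k⟧ := by
    rw [zdPartitionFunction_eq_ofReal ρ hρ β, ENNReal.toReal_ofReal (integral_nonneg fun U => prod_nonneg fun _ _ => (Real.exp_pos _).le)]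
    refine integral_mono hiQ hiT fun U => ?_
    refine (prod_labelWeight_le_of_subset ρ hρN hβ (image_ofZd_tiling_subset n k) U).trans (le_of_eq ?_)
    exact prod_image_ofZd ρ β _ U
  have h2 : ℨ⟦β, tiling d n k⟧ = ℨ⟦β, 𝔅⟦n⟧⟧ ^ k ^ d := by
    rw [tiling, FreeEnergy.zdZ_biUnion_translate ρ hρ β (le_refl (n + 1)), card_halfOpenBox]
  have h3 : ℨ⟦β, 𝔅⟦n⟧⟧ ≤ (zdPartitionFunction ρ β (halfOpenBox d n)).toReal := by
    rw [zdPartitionFunction_toReal_eq ρ hρ β n]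
    exact integral_mono hiB hiC fun U => prod_boxWeight_le_of_subset ρ hρN hβ (cubePlaqs_subset n) U
  have hpos : 0 < (zdPartitionFunction ρ β (halfOpenBox d ((n + 1) * k))).toReal := by
    rw [zdPartitionFunction_toReal_eq ρ hρ β]; exact FreeEnergy.zdZ_pos ρ hρ β _
  have hBpos : 0 < ℨ⟦β, 𝔅⟦n⟧⟧ := FreeEnergy.zdZ_pos ρ hρ β _
  calc Real.log (zdPartitionFunction ρ β (halfOpenBox d ((n + 1) * k))).toReal
      ≤ Real.log (ℨ⟦β, 𝔅⟦n⟧⟧ ^ k ^ d) := Real.log_le_log hpos (h1.trans (le_of_eq h2))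
    _ = k ^ d * Real.log ℨ⟦β, 𝔅⟦n⟧⟧ := by rw [Real.log_pow, Nat.cast_pow]
    _ ≤ k ^ d * Real.log (zdPartitionFunction ρ β (halfOpenBox d n)).toReal := by
        gcongr

/-- **Lower scale comparison (Lemma 17.5)**: with `|Re tr ρ| ≤ M`,
`k^d (log Z(B_n) - 2|β|(N+M)·#planes·n^{d-1}) - |β|(N+M)·#planes·k^d((n+1)^d - n^d) ≤ log Z(B_{(n+1)k})`. [cite: arXiv160201222, Lemma 17.5] -/
theorem le_log_Z_mul (hρ : Continuous ρ) {M : ℝ} (hM : ∀ g, |(ρ g).trace.re| ≤ M) (β : ℝ) (n k : ℕ) :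
    (k : ℝ) ^ d * (Real.log (zdPartitionFunction ρ β (halfOpenBox d n)).toReal -
        |β| * (N + M) * (2 * Fintype.card {q : Fin d × Fin d // q.1 < q.2} * (n : ℝ) ^ (d - 1))) -
      |β| * (N + M) * (Fintype.card {q : Fin d × Fin d // q.1 < q.2} * ((k : ℝ) ^ d * (((n + 1 : ℕ) : ℝ) ^ d - (n : ℝ) ^ d))) ≤
      Real.log (zdPartitionFunction ρ β (halfOpenBox d ((n + 1) * k))).toReal := by
  set D : ℕ := Fintype.card {q : Fin d × Fin d // q.1 < q.2} with hD
  set K : ℝ := |β| * (N + M) with hK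
  have hM0 : 0 ≤ M := (abs_nonneg _).trans (hM 1)
  have hK0 : 0 ≤ K := by positivity
  set Q : Finset (Plaq d) := plaquettesIn (halfOpenBox d ((n + 1) * k)) with hQ
  set Tl : Finset (Plaq d) := (tiling d n k).image Plaq.ofZd with hTl
  have hTlQ : Tl ⊆ Q := image_ofZd_tiling_subset n k
  have hiQ : Integrable (fun U : ZdGaugeConfig d G => ∏ q ∈ Q, 𝔳⟦β, q, U⟧) (zdHaar d G) :=
    AreaLaw.integrable_zdHaar_of_continuous (continuous_labelWeight ρ hρ β Q)
  have hiT : Integrable (fun U : ZdGaugeConfig d G => ∏ p ∈ tiling d n k, 𝔴⟦β, p, U⟧) (zdHaar d G) :=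
    FreeEnergy.integrable_boxWeight ρ hρ β _
  have hiB : Integrable (fun U : ZdGaugeConfig d G => ∏ p ∈ 𝔅⟦n⟧, 𝔴⟦β, p, U⟧) (zdHaar d G) :=
    FreeEnergy.integrable_boxWeight ρ hρ β _
  have hiC : Integrable (fun U : ZdGaugeConfig d G => ∏ p ∈ cubePlaqs d n, 𝔴⟦β, p, U⟧) (zdHaar d G) :=
    FreeEnergy.integrable_boxWeight ρ hρ β _
  -- cardinalities of the dropped sets
  have hcardTl : #Tl = k ^ d * (n ^ d * D) := by
    rw [hTl, card_image_of_injective _ Plaq.ofZd_injective, card_tiling]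
  have hcardQ : #Q ≤ ((n + 1) * k) ^ d * D := card_plaquettesIn_halfOpenBox_le _
  have hcard1 : (#(Q \ Tl) : ℝ) ≤ D * ((k : ℝ) ^ d * (((n + 1 : ℕ) : ℝ) ^ d - (n : ℝ) ^ d)) := by
    have h := card_sdiff_add_card_eq_card hTlQ
    have h' : #(Q \ Tl) + k ^ d * (n ^ d * D) ≤ ((n + 1) * k) ^ d * D := by rw [← hcardTl, h]; exact hcardQ
    have h'' : (#(Q \ Tl) : ℝ) + (k : ℝ) ^ d * ((n : ℝ) ^ d * D) ≤ (((n + 1 : ℕ) : ℝ) * k) ^ d * D := by exact_mod_cast h'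
    rw [mul_pow] at h''
    nlinarith
  have hcard2 : (#(𝔅⟦n⟧ \ cubePlaqs d n) : ℝ) ≤ 2 * D * (n : ℝ) ^ (d - 1) := by
    exact_mod_cast card_boxPlaqs_sdiff_cubePlaqs_le (d := d) n
  -- `Z(B_big) ≥ e^{-K #(Q∖Tl)} Z(tiling)`, `Z(𝔅⟦n⟧) ≥ e^{-K #(𝔅∖cube)} Z(cube)`
  have h1 : Real.exp (-K) ^ #(Q \ Tl) * ℨ⟦β, tiling d n k⟧ ≤ (zdPartitionFunction ρ β (halfOpenBox d ((n + 1) * k))).toReal := by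
    rw [zdPartitionFunction_eq_ofReal ρ hρ β, ENNReal.toReal_ofReal (integral_nonneg fun U => prod_nonneg fun _ _ => (Real.exp_pos _).le),
      ← integral_const_mul]
    refine integral_mono (hiT.const_mul _) hiQ fun U => ?_
    have := pow_mul_prod_labelWeight_le ρ hM β hTlQ U
    rwa [hTl, prod_image_ofZd] at this
  have h2 : ℨ⟦β, tiling d n k⟧ = ℨ⟦β, 𝔅⟦n⟧⟧ ^ k ^ d := by
    rw [tiling, FreeEnergy.zdZ_biUnion_translate ρ hρ β (le_refl (n + 1)), card_halfOpenBox]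
  have h3 : Real.exp (-K) ^ #(𝔅⟦n⟧ \ cubePlaqs d n) * (zdPartitionFunction ρ β (halfOpenBox d n)).toReal ≤ ℨ⟦β, 𝔅⟦n⟧⟧ := by
    rw [zdPartitionFunction_toReal_eq ρ hρ β n, ← integral_const_mul]
    exact integral_mono (hiC.const_mul _) hiB fun U => pow_mul_prod_boxWeight_le ρ hM β (cubePlaqs_subset n) U
  -- logarithms
  have hZn : 0 < (zdPartitionFunction ρ β (halfOpenBox d n)).toReal := by
    rw [zdPartitionFunction_toReal_eq ρ hρ β]; exact FreeEnergy.zdZ_pos ρ hρ β _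
  have hBpos : 0 < ℨ⟦β, 𝔅⟦n⟧⟧ := FreeEnergy.zdZ_pos ρ hρ β _
  have hTpos : 0 < ℨ⟦β, tiling d n k⟧ := FreeEnergy.zdZ_pos ρ hρ β _
  have hl3 : #(𝔅⟦n⟧ \ cubePlaqs d n) * (-K) + Real.log (zdPartitionFunction ρ β (halfOpenBox d n)).toReal ≤ Real.log ℨ⟦β, 𝔅⟦n⟧⟧ := by
    have := Real.log_le_log (mul_pos (pow_pos (Real.exp_pos _) _) hZn) h3
    rwa [Real.log_mul (pow_pos (Real.exp_pos _) _).ne' hZn.ne', Real.log_pow, Real.log_exp] at this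
  have hl1 : #(Q \ Tl) * (-K) + (k : ℝ) ^ d * Real.log ℨ⟦β, 𝔅⟦n⟧⟧ ≤
      Real.log (zdPartitionFunction ρ β (halfOpenBox d ((n + 1) * k))).toReal := by
    have := Real.log_le_log (mul_pos (pow_pos (Real.exp_pos _) _) hTpos) h1
    rw [Real.log_mul (pow_pos (Real.exp_pos _) _).ne' hTpos.ne', Real.log_pow, Real.log_exp, h2, Real.log_pow,
      Nat.cast_pow] at this
    exact this
  have hkd : (0 : ℝ) ≤ (k : ℝ) ^ d := by positivity
  have e1 : (#(Q \ Tl) : ℝ) * K ≤ K * (D * ((k : ℝ) ^ d * (((n + 1 : ℕ) : ℝ) ^ d - (n : ℝ) ^ d))) := by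
    rw [mul_comm]; exact mul_le_mul_of_nonneg_left hcard1 hK0
  have e2 : (#(𝔅⟦n⟧ \ cubePlaqs d n) : ℝ) * K ≤ K * (2 * D * (n : ℝ) ^ (d - 1)) := by
    rw [mul_comm]; exact mul_le_mul_of_nonneg_left hcard2 hK0
  have f1 : (k : ℝ) ^ d * (Real.log (zdPartitionFunction ρ β (halfOpenBox d n)).toReal - K * (2 * D * (n : ℝ) ^ (d - 1))) ≤
      (k : ℝ) ^ d * Real.log ℨ⟦β, 𝔅⟦n⟧⟧ := by
    apply mul_le_mul_of_nonneg_left _ hkd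
    linarith [hl3, e2]
  linarith [f1, hl1, e1]

/-! ### Consequences for the free energy density -/

/-- `(n+1)^d - n^d ≤ d (n+1)^{d-1}` (real numbers). [folklore] -/
theorem pow_succ_sub_pow_le (n : ℕ) : ∀ d : ℕ, ((n : ℝ) + 1) ^ d - (n : ℝ) ^ d ≤ d * ((n : ℝ) + 1) ^ (d - 1)
  | 0 => by simp
  | (d + 1) => by
    have ih := pow_succ_sub_pow_le n d
    have hn : (0 : ℝ) ≤ n := Nat.cast_nonneg n
    have h1 : (n : ℝ) ^ d ≤ ((n : ℝ) + 1) ^ d := pow_le_pow_left₀ hn (by linarith) d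
    have h2 : (0 : ℝ) ≤ ((n : ℝ) + 1) ^ (d - 1) := by positivity
    simp only [Nat.add_sub_cancel, pow_succ]
    push_cast
    rcases Nat.eq_zero_or_pos d with hd | hd
    · subst hd; simp
    · have hpow : ((n : ℝ) + 1) ^ d = ((n : ℝ) + 1) ^ (d - 1) * ((n : ℝ) + 1) := by
        rw [← pow_succ, Nat.sub_add_cancel hd]
      nlinarith [ih, h1, h2, hpow]

omit [SecondCountableTopology G] in
/-- The free energy per site of a cube in terms of `log Z`. [folklore] -/
theorem freeEnergyPerSite_halfOpenBox_eq (β : ℝ) (L : ℕ) :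
    freeEnergyPerSite ρ β (halfOpenBox d L) = Real.log (zdPartitionFunction ρ β (halfOpenBox d L)).toReal / (L : ℝ) ^ d := by
  simp [freeEnergyPerSite, card_halfOpenBox]

/-- The cube free energies along the multiples `(n+1)k` converge to the free energy density. [folklore] -/
theorem tendsto_freeEnergyPerSite_mul (hρ : Continuous ρ) (β : ℝ) (n : ℕ) :
    Tendsto (fun k : ℕ => freeEnergyPerSite ρ β (halfOpenBox d ((n + 1) * k))) atTop (𝓝 (freeEnergyDensity d ρ β)) :=
  (tendsto_freeEnergyPerSite_halfOpenBox ρ hρ β).comp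
    (tendsto_atTop_mono (fun k => Nat.le_mul_of_pos_left k (Nat.succ_pos n)) tendsto_id)

/-- **Lemma 17.3 (upper bound on `f`)**: for `β ≥ 0` and `Re tr ρ ≤ N`,
`f(β) ≤ log Z(B_n, β)/(n+1)^d` (`= (n/(n+1))^d F(B_n, β)`). [cite: arXiv160201222, Lemma 17.3] -/
theorem freeEnergyDensity_le (hρ : Continuous ρ) (hρN : ∀ g, (ρ g).trace.re ≤ N) {β : ℝ} (hβ : 0 ≤ β) (n : ℕ) :
    freeEnergyDensity d ρ β ≤ Real.log (zdPartitionFunction ρ β (halfOpenBox d n)).toReal / ((n : ℝ) + 1) ^ d := by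
  refine le_of_tendsto (tendsto_freeEnergyPerSite_mul ρ hρ β n) ?_
  filter_upwards [eventually_ge_atTop 1] with k hk
  rw [freeEnergyPerSite_halfOpenBox_eq]
  have h := log_Z_mul_le (d := d) ρ hρ hρN hβ n k
  have hk0 : (0 : ℝ) < (k : ℝ) ^ d := by positivity
  have hn0 : (0 : ℝ) < ((n : ℝ) + 1) ^ d := by positivity
  rw [div_le_div_iff₀ (by push_cast; positivity) hn0]
  push_cast
  rw [mul_pow]
  nlinarith [mul_le_mul_of_nonneg_left h hn0.le]

/-- **Lemma 17.5 (lower bound on `f`)**: with `|Re tr ρ| ≤ M`, for every real `β` and `n`,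
`log Z(B_n, β)/(n+1)^d - |β|(N+M)·#planes·(d+2)/(n+1) ≤ f(β)`. [cite: arXiv160201222, Lemma 17.5] -/
theorem le_freeEnergyDensity (hρ : Continuous ρ) {M : ℝ} (hM : ∀ g, |(ρ g).trace.re| ≤ M) (β : ℝ) (n : ℕ) :
    Real.log (zdPartitionFunction ρ β (halfOpenBox d n)).toReal / ((n : ℝ) + 1) ^ d -
        |β| * (N + M) * Fintype.card {q : Fin d × Fin d // q.1 < q.2} * (d + 2) / ((n : ℝ) + 1) ≤
      freeEnergyDensity d ρ β := by
  set D : ℕ := Fintype.card {q : Fin d × Fin d // q.1 < q.2} with hD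
  set K : ℝ := |β| * (N + M) with hK
  have hM0 : 0 ≤ M := (abs_nonneg _).trans (hM 1)
  have hK0 : 0 ≤ K := by positivity
  refine ge_of_tendsto (tendsto_freeEnergyPerSite_mul ρ hρ β n) ?_
  filter_upwards [eventually_ge_atTop 1] with k hk
  rw [freeEnergyPerSite_halfOpenBox_eq]
  have h := le_log_Z_mul (d := d) ρ hρ hM β n k
  have hk0 : (0 : ℝ) < (k : ℝ) ^ d := by positivity
  have hn1 : (0 : ℝ) < (n : ℝ) + 1 := by positivity
  have hn0 : (0 : ℝ) < ((n : ℝ) + 1) ^ d := by positivity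
  -- the error numerator is at most `(d+2)(n+1)^{d-1}`
  have herr : 2 * (n : ℝ) ^ (d - 1) + (((n : ℝ) + 1) ^ d - (n : ℝ) ^ d) ≤ (d + 2) * ((n : ℝ) + 1) ^ (d - 1) := by
    have h1 := pow_succ_sub_pow_le n d
    have h2 : (n : ℝ) ^ (d - 1) ≤ ((n : ℝ) + 1) ^ (d - 1) := pow_le_pow_left₀ (Nat.cast_nonneg n) (by linarith) _
    nlinarith
  have hpow : ((n : ℝ) + 1) ^ d = ((n : ℝ) + 1) ^ (d - 1) * ((n : ℝ) + 1) ∨ d = 0 := by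
    rcases Nat.eq_zero_or_pos d with hd | hd
    · exact Or.inr hd
    · left; rw [← pow_succ, Nat.sub_add_cancel hd]
  rw [le_div_iff₀ (by push_cast; positivity)]
  push_cast at h ⊢
  rw [mul_pow]
  -- `LHS * ((n+1)^d k^d) ≤ log Z_big`
  have hmain : (Real.log (zdPartitionFunction ρ β (halfOpenBox d n)).toReal / ((n : ℝ) + 1) ^ d -
      K * D * (d + 2) / ((n : ℝ) + 1)) * (((n : ℝ) + 1) ^ d * (k : ℝ) ^ d) ≤
      (k : ℝ) ^ d * (Real.log (zdPartitionFunction ρ β (halfOpenBox d n)).toReal - K * (2 * D * (n : ℝ) ^ (d - 1))) -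
        K * (D * ((k : ℝ) ^ d * (((n : ℝ) + 1) ^ d - (n : ℝ) ^ d))) := by
    rcases hpow with hpow | hd
    · rw [sub_mul, div_mul_eq_mul_div, mul_div_assoc, show ((n : ℝ) + 1) ^ d * (k : ℝ) ^ d / ((n : ℝ) + 1) ^ d = (k : ℝ) ^ d by
        field_simp]
      rw [show K * ↑D * (↑d + 2) / (↑n + 1) * ((↑n + 1) ^ d * ↑k ^ d) = K * D * (d + 2) * ((n : ℝ) + 1) ^ (d - 1) * (k : ℝ) ^ d by
        rw [hpow]; field_simp]
      have := mul_le_mul_of_nonneg_left herr (mul_nonneg (mul_nonneg hK0 (Nat.cast_nonneg D)) hk0.le)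
      nlinarith [this]
    · subst hd; simp
  exact hmain.trans h

end ChatterjeeFreeEnergy

end Literature.MathematicalPhysics.QuantumFieldTheory
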